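import Summits.QuantumAdvantage.QuantumAdvantage.Theorems.LinnikCubicClassGroupsDegreeOnePrimesEscapeClassPNTAdditiveEps
import Summits.QuantumAdvantage.QuantumAdvantage.Theorems.LinnikCubicClassGroupsDegreeOnePrimesEscapeResidueAllFields
import Summits.QuantumAdvantage.QuantumAdvantage.Theorems.LinnikCubicClassGroupsDegreeOnePrimesEscapeLowerShadow
import Literature.NumberTheory.LFunctions.ClassGroupLFunctionNoExceptionalZeroOddDegree
import Literature.NumberTheory.LFunctions.UniformClassGroupPNTReduction
import HarnessLib

/-!
# The class prime number theorem with NO exceptional term for every number field of ODD degree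
# (in particular every cubic field), and a Linnik-type bound for the least prime ideal in a class

Topic `Summits/QuantumAdvantage/QuantumAdvantage/Theorems`, cell B2b-1 (linnik-cubic), PART A seat 4;
helper for the crux `DegreeOnePrimesEscape` (stmt-QuantumAdvantage-11543) of route `LinnikCubicClassGroups`.
HONEST FRAMING: the value of this file is a THEOREM (kernel-checked, GRH-free, Siegel-free) — NOT summit
progress (the route still rests on the hypothesis-type target `PureCubicClassNumberHard`).

The tree's additive class prime number theorem (files VIII–XIII of PART A seat 3 and PART B seat 4:
`classPNTAdditive_eps_of_kappa_local` + `Residue.residueLowerBound_all`) is a DICHOTOMY: either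
`|π_C(x) − Li(x)/h| ≤ ε Li(x)/h` for all classes, or the same with the exceptional main term
`Li(x) − Re χ₁(C)·Li(x^{β₁})` for a real zero `β₁ ∈ (1 − 1/(8 log Q), 1)` of a real class group
character `χ₁`.  By `classGroupLFunction_ne_zero_of_odd` (Literature: Stark's theorem for `K` and for the
quadratic class field of `χ₁`, which has no quadratic subfield when `[K:ℚ]` is odd) such a zero satisfies
`β₁ ≤ 1 − 1/(8·(2n)!·log Q)` in ODD degree `n`, and then `Li(x^{β₁}) ≤ (ε/2)·Li(x)` once `x ≥ Q^{c₀(n,ε)}`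
(`offsetLogIntegral_rpow_le_mul`), so the exceptional term is absorbed:

* `classPNT_eps_of_odd (n) (ε)` — **for odd `n > 1` and `ε > 0` there is `c₁ > 0` such that for EVERY
  number field `K` of degree `n`, every ideal class `C` and every `x ≥ Q^{c₁}` (`Q = |d_K|·nⁿ`):
  `|π_C(x) − Li(x)/h_K| ≤ ε · Li(x)/h_K`** — no exceptional term, no hypothesis;
* `classPNT_eps_allCubicFields (ε)` — the case `n = 3` (all cubic fields; `Q = 27|d_K|`), upgrading
  `classPNT_eps_cubic_of_odd_classNumber` (odd class number only) of file XIII;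
* `exists_prime_mem_class_absNorm_le_of_odd (n)` / `exists_prime_mem_class_absNorm_le_cubic` —
  **Linnik's theorem for ideal classes**: there is `L = L(n) > 0` such that every ideal class of every
  number field of odd degree `n` (resp. every cubic field) contains a prime ideal of norm `≤ Q^{L}`.

## References

* J. Thorner, A. Zaman, *A unified and improved Chebotarev density theorem*, Algebra Number Theory 13
  (2019), Thm. 1.4 (the dichotomy with `β₁`). [ThornerZaman2019]
* H. M. Stark, *Some effective cases of the Brauer–Siegel theorem*, Invent. Math. 23 (1974), Thm. 3.
  [Stark1974]
* A. Weiss, *The least prime ideal*, J. reine angew. Math. 338 (1983) 56–94 (least prime ideal in a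
  class, via Deuring–Heilbronn; here avoided in odd degree). [Weiss1983]
-/

noncomputable section

open Complex Real MeasureTheory Set Filter Topology
open scoped NumberField nonZeroDivisors

namespace Summit.QuantumAdvantage.QuantumAdvantage.Theorems.DegreeOnePrimesEscape

open Literature.NumberTheory.LFunctions Literature.NumberTheory.LFunctions.NumberField
  Literature.NumberTheory.LFunctions.AbelianDensity

/-! ### Absorption of a not-too-exceptional zero: `Li(x^β) ≤ ε·Li(x)` -/

/-- **Absorption lemma.**  For `c, ε > 0` there is `c₀ > 0` such that for `Q ≥ 12`,
`1/2 ≤ β ≤ 1 − c/log Q` and `x ≥ Q^{c₀}`:  `0 ≤ Li(x^β) ≤ ε · Li(x)`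
(`Li(y) ≤ (26/25) y/log y` for `y ≥ e^{60}`, `Li(x) ≥ (x−2)/log x`, and `x^{β−1} ≤ e^{−c c₀}`).
[folklore] -/
theorem offsetLogIntegral_rpow_le_mul {c ε : ℝ} (hc : 0 < c) (hε : 0 < ε) :
    ∃ c₀ : ℝ, 0 < c₀ ∧ ∀ Q : ℝ, 12 ≤ Q → ∀ β : ℝ, 1 / 2 ≤ β → β ≤ 1 - c / Real.log Q →
      ∀ x : ℝ, Q ^ c₀ ≤ x →
        0 ≤ offsetLogIntegral (x ^ β) ∧ offsetLogIntegral (x ^ β) ≤ ε * offsetLogIntegral x := by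
  set c₀ : ℝ := max 60 ((Real.log 5 - Real.log ε) / c) with hc₀
  refine ⟨c₀, lt_of_lt_of_le (by norm_num) (le_max_left _ _), fun Q hQ β hβ hβc x hx => ?_⟩
  have hQ1 : (1 : ℝ) < Q := by linarith
  have hlogQ : 2 ≤ Real.log Q := two_lt_log_twelve.le.trans (Real.log_le_log (by norm_num) hQ)
  have hlogQ0 : 0 < Real.log Q := by linarith
  have hc₀60 : (60 : ℝ) ≤ c₀ := le_max_left _ _
  have hc₀ε : (Real.log 5 - Real.log ε) / c ≤ c₀ := le_max_right _ _
  -- `log x ≥ c₀ log Q ≥ 120`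
  have hxQ : Q ≤ x := by
    have : Q ^ (1 : ℝ) ≤ Q ^ c₀ := Real.rpow_le_rpow_of_exponent_le hQ1.le (by linarith)
    rw [Real.rpow_one] at this; linarith
  have hx0 : 0 < x := by linarith
  have hlogx : c₀ * Real.log Q ≤ Real.log x := by
    have := Real.log_le_log (by positivity) hx
    rwa [Real.log_rpow (by linarith)] at this
  have hlogx120 : 120 ≤ Real.log x := by nlinarith
  -- `y = x^β ≥ e^{60}`
  set y : ℝ := x ^ β with hy
  have hy0 : 0 < y := Real.rpow_pos_of_pos hx0 β
  have hlogy : Real.log y = β * Real.log x := by rw [hy, Real.log_rpow hx0]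
  have hlogy60 : 60 ≤ Real.log y := by rw [hlogy]; nlinarith
  have hy60 : Real.exp 60 ≤ y := by
    rw [← Real.exp_log hy0]; exact Real.exp_le_exp.mpr hlogy60
  have he60 : (2 : ℝ) ≤ Real.exp 60 := by
    have := Real.add_one_le_exp (60:ℝ); linarith
  have hy2 : 2 ≤ y := he60.trans hy60
  have hLi0 : 0 ≤ offsetLogIntegral y := by
    have h0 := offsetLogIntegralPow_nonneg 1 hy2
    rwa [offsetLogIntegralPow_one] at h0
  refine ⟨hLi0, ?_⟩
  -- upper bound for `Li(y)` and lower bound for `Li(x)`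
  have hLiy : offsetLogIntegral y ≤ 26 / 25 * (y / Real.log y) := Dock.offsetLogIntegral_le_mul_div_log hy60
  have hlogx0 : 0 < Real.log x := by linarith
  have hLiy' : offsetLogIntegral y ≤ 52 / 25 * y / Real.log x := by
    have h1 : y / Real.log y ≤ 2 * y / Real.log x := by
      rw [hlogy, div_le_div_iff₀ (by positivity) hlogx0]
      nlinarith [mul_nonneg (mul_pos hy0 hlogx0).le (show (0:ℝ) ≤ 2 * β - 1 by linarith)]
    calc offsetLogIntegral y ≤ 26 / 25 * (y / Real.log y) := hLiy
      _ ≤ 26 / 25 * (2 * y / Real.log x) := by gcongr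
      _ = 52 / 25 * y / Real.log x := by ring
  have hx2 : (2 : ℝ) ≤ x := by
    have : Real.exp 60 ≤ x := by
      rw [← Real.exp_log hx0]; exact Real.exp_le_exp.mpr (by linarith)
    linarith
  have hLix : (x - 2) * (Real.log x)⁻¹ ≤ offsetLogIntegral x := by
    have := sub_mul_inv_log_pow_le_offsetLogIntegralPow 1 hx2
    rwa [pow_one, offsetLogIntegralPow_one] at this
  have hx4 : (4 : ℝ) ≤ x := by
    have h4 : (4:ℝ) ≤ Real.exp 60 := by have := Real.add_one_le_exp (60:ℝ); linarith
    have : Real.exp 60 ≤ x := by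
      rw [← Real.exp_log hx0]; exact Real.exp_le_exp.mpr (by linarith)
    linarith
  have hLix' : x / (2 * Real.log x) ≤ offsetLogIntegral x := by
    have h1 : x / (2 * Real.log x) ≤ (x - 2) * (Real.log x)⁻¹ := by
      rw [← div_eq_mul_inv, div_le_div_iff₀ (by positivity) hlogx0]
      nlinarith
    linarith
  -- `y ≤ (ε/5) x`
  have hyx : y ≤ ε / 5 * x := by
    have hβ1 : (β - 1) * Real.log x ≤ -(c * c₀) := by
      have h1 : β - 1 ≤ -(c / Real.log Q) := by linarith
      have h2 : (β - 1) * Real.log x ≤ -(c / Real.log Q) * Real.log x :=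
        mul_le_mul_of_nonneg_right h1 hlogx0.le
      have h3 : -(c / Real.log Q) * Real.log x ≤ -(c / Real.log Q) * (c₀ * Real.log Q) := by
        have : 0 ≤ c / Real.log Q := by positivity
        nlinarith
      have h4 : -(c / Real.log Q) * (c₀ * Real.log Q) = -(c * c₀) := by
        field_simp
      linarith
    have hcc₀ : Real.log 5 - Real.log ε ≤ c * c₀ := by
      have := (div_le_iff₀ hc).mp hc₀ε
      linarith
    have hyeq : y = x * Real.exp ((β - 1) * Real.log x) := by
      rw [hy, Real.rpow_def_of_pos hx0, sub_mul, one_mul, Real.exp_sub, Real.exp_log hx0]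
      field_simp
    rw [hyeq]
    have hexp : Real.exp ((β - 1) * Real.log x) ≤ ε / 5 := by
      calc Real.exp ((β - 1) * Real.log x) ≤ Real.exp (-(Real.log 5 - Real.log ε)) :=
            Real.exp_le_exp.mpr (by linarith)
        _ = ε / 5 := by
            rw [neg_sub, Real.exp_sub, Real.exp_log hε, Real.exp_log (by norm_num)]
    nlinarith
  -- conclusion
  calc offsetLogIntegral y ≤ 52 / 25 * y / Real.log x := hLiy'
    _ ≤ 52 / 25 * (ε / 5 * x) / Real.log x := by
        gcongr
    _ = (52 / 125 * ε) * (x / Real.log x) := by ring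
    _ ≤ ε * (x / (2 * Real.log x)) := by
        have hxl : 0 < x / Real.log x := div_pos hx0 hlogx0
        have heq : ε * (x / (2 * Real.log x)) = (ε / 2) * (x / Real.log x) := by
          field_simp
        rw [heq]
        nlinarith
    _ ≤ ε * offsetLogIntegral x := mul_le_mul_of_nonneg_left hLix' hε.le

/-! ### The class prime number theorem with no exceptional term, odd degree -/

/-- **Every number field of ODD degree `n > 1`: two-sided class prime number theorem with NO
exceptional term, unconditionally.**  For odd `n > 1` and `ε > 0` there is `c₁ > 0` such that for every
number field `K` of degree `n`, every ideal class `C` and every `x ≥ Q^{c₁}` (`Q = |d_K|·nⁿ`):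
`|π_C(x) − Li(x)/h_K| ≤ ε·Li(x)/h_K`.  (The exceptional alternative of `classPNTAdditive_eps_of_kappa_local`
— residue hypothesis discharged by `Residue.residueLowerBound_all` — has `β₁ ≤ 1 − 1/(8(2n)!·log Q)` by
`classGroupLFunction_ne_zero_of_odd`, and is absorbed by `offsetLogIntegral_rpow_le_mul`.) -/
theorem classPNT_eps_of_odd (n : ℕ) (hn : 1 < n) (hodd : Odd n) {ε : ℝ} (hε : 0 < ε) :
    ∃ c₁ : ℝ, 0 < c₁ ∧ ∀ (K : Type) [Field K] [NumberField K], Module.finrank ℚ K = n →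
      ∀ (C : ClassGroup (𝓞 K)) (x : ℝ), ThornerZaman.condQn K ^ c₁ ≤ x →
        |(primeIdealClassCount K C x : ℝ) - offsetLogIntegral x / NumberField.classNumber K| ≤
          ε * offsetLogIntegral x / NumberField.classNumber K := by
  classical
  obtain ⟨A, -, hA⟩ := Residue.residueLowerBound_all n
  obtain ⟨c₁, hc₁, h⟩ := classPNTAdditive_eps_of_kappa_local n hn A (half_pos hε)
  set c : ℝ := 1 / (8 * ((2 * n).factorial : ℝ)) with hcdef
  have hc : 0 < c := by positivity
  obtain ⟨c₀, hc₀, habs⟩ := offsetLogIntegral_rpow_le_mul hc (half_pos hε)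
  refine ⟨max (max c₁ c₀) 1, lt_max_of_lt_right one_pos, fun K _ _ hKn C x hx => ?_⟩
  have hK : 1 < Module.finrank ℚ K := by rw [hKn]; exact hn
  set Q : ℝ := ThornerZaman.condQn K with hQ
  have hQ12 : (12 : ℝ) ≤ Q := ThornerZaman.twelve_le_condQn (K := K) hK
  have hQ1 : (1 : ℝ) < Q := by linarith
  have hlogQ : 2 ≤ Real.log Q := two_lt_log_twelve.le.trans (Real.log_le_log (by norm_num) hQ12)
  have hx₁ : Q ^ c₁ ≤ x :=
    (Real.rpow_le_rpow_of_exponent_le hQ1.le ((le_max_left _ _).trans (le_max_left _ _))).trans hx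
  have hx₀ : Q ^ c₀ ≤ x :=
    (Real.rpow_le_rpow_of_exponent_le hQ1.le ((le_max_right _ _).trans (le_max_left _ _))).trans hx
  have hxQ : Q ≤ x := by
    have := (Real.rpow_le_rpow_of_exponent_le hQ1.le (le_max_right (max c₁ c₀) 1)).trans hx
    rwa [Real.rpow_one] at this
  set hcl : ℝ := (NumberField.classNumber K : ℝ) with hh
  have hh0 : 0 < hcl := by
    rw [hh]; exact_mod_cast Nat.lt_of_lt_of_le Nat.zero_lt_one (one_le_classNumber (K := K))
  rcases h K hKn (hA K hKn) with h1 | ⟨χ₁, β₁, hreal, hβQ, hβ1, hz, hbd⟩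
  · have := h1 C x hx₁
    calc _ ≤ ε / 2 * offsetLogIntegral x / hcl := this
      _ ≤ ε * offsetLogIntegral x / hcl := by
          have hLi : 0 ≤ offsetLogIntegral x := by
            have h0 := offsetLogIntegralPow_nonneg 1 (show (2:ℝ) ≤ x by linarith)
            rwa [offsetLogIntegralPow_one] at h0
          gcongr; linarith
  · -- the zero is NOT exceptional: `β₁ ≤ 1 − c/log Q`
    have hβc : β₁ ≤ 1 - c / Real.log Q := by
      by_contra hlt
      push Not at hlt
      have hd3 : (3 : ℝ) ≤ ((NumberField.discr K).natAbs : ℝ) := by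
        have h2 := NumberField.abs_discr_gt_two hK
        rw [Nat.cast_natAbs]
        exact_mod_cast (show (3 : ℤ) ≤ |NumberField.discr K| by omega)
      have hlogd : 0 < Real.log ((NumberField.discr K).natAbs : ℝ) := Real.log_pos (by linarith)
      have hdQ : Real.log ((NumberField.discr K).natAbs : ℝ) ≤ Real.log Q := by
        refine Real.log_le_log (by linarith) ?_
        rw [Nat.cast_natAbs, Int.cast_abs]
        exact ThornerZaman.abs_discr_le_condQn K
      have hσ : 1 - 1 / (8 * ((2 * Module.finrank ℚ K).factorial : ℝ) *
          Real.log ((NumberField.discr K).natAbs : ℝ)) ≤ β₁ := by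
        rw [hKn]
        have h1 : c / Real.log Q ≤ c / Real.log ((NumberField.discr K).natAbs : ℝ) :=
          div_le_div_of_nonneg_left hc.le hlogd hdQ
        have h2 : c / Real.log ((NumberField.discr K).natAbs : ℝ) =
            1 / (8 * ((2 * n).factorial : ℝ) * Real.log ((NumberField.discr K).natAbs : ℝ)) := by
          rw [hcdef]; field_simp
        linarith
      exact classGroupLFunction_ne_zero_of_odd K (by rw [hKn]; exact hodd) hK χ₁ hreal hσ hβ1 hz
    have hβhalf : 1 / 2 ≤ β₁ := by
      have : 1 / (8 * Real.log Q) ≤ 1 / 16 := by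
        rw [div_le_div_iff₀ (by positivity) (by norm_num)]; nlinarith
      linarith
    obtain ⟨hLi0, hLiβ⟩ := habs Q hQ12 β₁ hβhalf hβc x hx₀
    have hmain := hbd C x hx₁
    -- `|Re χ₁(C)| ≤ 1`
    have hre : |((χ₁ C : ℂ)).re| ≤ 1 := by
      rcases re_classGroupChar_apply hreal C with h1 | h1 <;> rw [h1] <;> norm_num
    -- triangle inequality
    have hdiff : |(offsetLogIntegral x - ((χ₁ C : ℂ)).re * offsetLogIntegral (x ^ β₁)) / hcl -
        offsetLogIntegral x / hcl| ≤ ε / 2 * offsetLogIntegral x / hcl := by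
      rw [show (offsetLogIntegral x - ((χ₁ C : ℂ)).re * offsetLogIntegral (x ^ β₁)) / hcl -
          offsetLogIntegral x / hcl = -(((χ₁ C : ℂ)).re * offsetLogIntegral (x ^ β₁) / hcl) by ring,
        abs_neg, abs_div, abs_mul, abs_of_pos hh0, abs_of_nonneg hLi0]
      rw [div_le_div_iff_of_pos_right hh0]
      calc |((χ₁ C : ℂ)).re| * offsetLogIntegral (x ^ β₁) ≤ 1 * offsetLogIntegral (x ^ β₁) :=
            mul_le_mul_of_nonneg_right hre hLi0
        _ ≤ ε / 2 * offsetLogIntegral x := by rw [one_mul]; exact hLiβ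
    calc |(primeIdealClassCount K C x : ℝ) - offsetLogIntegral x / hcl|
        ≤ |(primeIdealClassCount K C x : ℝ) -
            (offsetLogIntegral x - ((χ₁ C : ℂ)).re * offsetLogIntegral (x ^ β₁)) / hcl| +
          |(offsetLogIntegral x - ((χ₁ C : ℂ)).re * offsetLogIntegral (x ^ β₁)) / hcl -
            offsetLogIntegral x / hcl| := abs_sub_le _ _ _
      _ ≤ ε / 2 * offsetLogIntegral x / hcl + ε / 2 * offsetLogIntegral x / hcl := add_le_add hmain hdiff
      _ = ε * offsetLogIntegral x / hcl := by ring

/-- **Every CUBIC field: two-sided class prime number theorem with NO exceptional term,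
unconditionally** (`Q = 27|d_K|`): for `ε > 0` there is `c₁ > 0` with
`|π_C(x) − Li(x)/h_K| ≤ ε·Li(x)/h_K` for every cubic `K`, every class `C`, every `x ≥ Q^{c₁}`.  This
upgrades `classPNT_eps_cubic_of_odd_classNumber` (file XIII) to ALL cubic fields. -/
theorem classPNT_eps_allCubicFields {ε : ℝ} (hε : 0 < ε) :
    ∃ c₁ : ℝ, 0 < c₁ ∧ ∀ (K : Type) [Field K] [NumberField K], Module.finrank ℚ K = 3 →
      ∀ (C : ClassGroup (𝓞 K)) (x : ℝ), ThornerZaman.condQn K ^ c₁ ≤ x →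
        |(primeIdealClassCount K C x : ℝ) - offsetLogIntegral x / NumberField.classNumber K| ≤
          ε * offsetLogIntegral x / NumberField.classNumber K :=
  classPNT_eps_of_odd 3 (by norm_num) ⟨1, rfl⟩ hε

/-! ### Linnik's theorem for ideal classes in odd degree -/

/-- **Least prime ideal in an ideal class, odd degree** (Linnik–Weiss type, here WITHOUT
Deuring–Heilbronn): for odd `n > 1` there is `L > 0` such that every ideal class `C` of every number field
`K` of degree `n` contains a prime ideal `𝔭` with `N𝔭 ≤ Q^{L}`, `Q = |d_K|·nⁿ`.
[cite: Weiss1983, Theorem 6.? (least prime ideal; here a different proof in odd degree)] -/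
theorem exists_prime_mem_class_absNorm_le_of_odd (n : ℕ) (hn : 1 < n) (hodd : Odd n) :
    ∃ L : ℝ, 0 < L ∧ ∀ (K : Type) [Field K] [NumberField K], Module.finrank ℚ K = n →
      ∀ C : ClassGroup (𝓞 K), ∃ (P : Ideal (𝓞 K)) (hP : P ∈ (Ideal (𝓞 K))⁰), P.IsPrime ∧
        ClassGroup.mk0 ⟨P, hP⟩ = C ∧ (Ideal.absNorm P : ℝ) ≤ ThornerZaman.condQn K ^ L := by
  classical
  obtain ⟨c₁, hc₁, h⟩ := classPNT_eps_of_odd n hn hodd (by norm_num : (0:ℝ) < 1 / 2)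
  refine ⟨max c₁ 1, lt_max_of_lt_left hc₁, fun K _ _ hKn C => ?_⟩
  have hK : 1 < Module.finrank ℚ K := by rw [hKn]; exact hn
  set Q : ℝ := ThornerZaman.condQn K with hQ
  have hQ12 : (12 : ℝ) ≤ Q := ThornerZaman.twelve_le_condQn (K := K) hK
  have hQ1 : (1 : ℝ) < Q := by linarith
  set x : ℝ := Q ^ (max c₁ 1) with hx
  have hx₁ : Q ^ c₁ ≤ x := Real.rpow_le_rpow_of_exponent_le hQ1.le (le_max_left _ _)
  have hxQ : Q ≤ x := by
    have := Real.rpow_le_rpow_of_exponent_le hQ1.le (le_max_right c₁ 1)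
    rwa [Real.rpow_one] at this
  have hx2 : (2 : ℝ) < x := by linarith
  have hlogx : 0 < Real.log x := Real.log_pos (by linarith)
  have hLi : 0 < offsetLogIntegral x := by
    have h1 := sub_mul_inv_log_pow_le_offsetLogIntegralPow 1 hx2.le
    rw [pow_one, offsetLogIntegralPow_one] at h1
    exact lt_of_lt_of_le (mul_pos (by linarith) (inv_pos.mpr hlogx)) h1
  set hK' : ℝ := (NumberField.classNumber K : ℝ) with hh
  have hh0 : 0 < hK' := by
    rw [hh]; exact_mod_cast Nat.lt_of_lt_of_le Nat.zero_lt_one (one_le_classNumber (K := K))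
  have hbound := h K hKn C x hx₁
  have hpos : 0 < (primeIdealClassCount K C x : ℝ) := by
    have h1 := (abs_sub_le_iff.mp hbound).2
    have h2 : 0 < offsetLogIntegral x / hK' - 1 / 2 * offsetLogIntegral x / hK' := by
      rw [← sub_div, show offsetLogIntegral x - 1 / 2 * offsetLogIntegral x = offsetLogIntegral x / 2 by ring]
      positivity
    linarith
  have hne : primeIdealClassCount K C x ≠ 0 := by
    intro h0; rw [h0, Nat.cast_zero] at hpos; exact lt_irrefl _ hpos
  obtain ⟨P, hPprime, hPx, hP0, hPC⟩ := Set.nonempty_of_ncard_ne_zero hne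
  exact ⟨P, hP0, hPprime, hPC, hPx⟩

/-- **Least prime ideal in an ideal class of a CUBIC field**: there is an absolute `L > 0` such that
every ideal class of every cubic number field `K` contains a prime ideal of norm at most
`(27|d_K|)^{L}` — unconditionally (no GRH, no Siegel hypothesis, no exceptional case). -/
theorem exists_prime_mem_class_absNorm_le_cubic :
    ∃ L : ℝ, 0 < L ∧ ∀ (K : Type) [Field K] [NumberField K], Module.finrank ℚ K = 3 →
      ∀ C : ClassGroup (𝓞 K), ∃ (P : Ideal (𝓞 K)) (hP : P ∈ (Ideal (𝓞 K))⁰), P.IsPrime ∧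
        ClassGroup.mk0 ⟨P, hP⟩ = C ∧ (Ideal.absNorm P : ℝ) ≤ ThornerZaman.condQn K ^ L :=
  exists_prime_mem_class_absNorm_le_of_odd 3 (by norm_num) ⟨1, rfl⟩

end Summit.QuantumAdvantage.QuantumAdvantage.Theorems.DegreeOnePrimesEscape

end
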